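import Summits.Ventures.PercRepro.MSRMStarMixed

/-!
# The mixed class: from a residue instance, and the consequences of monotonicity

`MixedII.of_residue`: a residue instance `Residue F u` with a tight trace at `r ∈ u`, `{r} ∈ F`,
`u ≠ univ` and `u.erase r ∉ F` (the negation of `CaseIOfComplex` at `r`) is in the mixed class
`MixedII r F (u.erase r)`: Case II `univ ∖ u.erase r ∈ F` from `erase_mem_or_compl_erase_mem`
(gen 21), the signs (†) read off `Cells` at the members `insert r t`, the C*-only member (‡)
from `¬ Tight (insert (univ ∖ u) F)` (`tight_insert_ubar_of_forall`: if every `t ∈ F₁` had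
`t ∩ u₀ ∈ Y`, `F ∪ {ū}` would be tight), validity from `hvalid`. Hence
`caseIOfComplex_of_not_mixed`: **the candidate Prop `CaseIOfComplex α` follows from the emptiness
of the mixed class** (plus «no residue near-member is `univ`»).

In the mixed class (monotone by `MixedII.monotone`): no member avoiding `r` lies inside `ū`
(`notMem_part0_of_subset_ubar`), and the C*-only witness `w = t₁ ∩ u₀` is an `r`-lifted face
(`witness_mem_partr`) met by every member avoiding `r` (`witness_meets`), with `u₀ ∖ w` an
`r`-lifted face as well (`sdiff_witness_mem_partr`) — the objects of the pair conjecture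
(Addendum 62 suppl. 1 (3)).
-/

namespace PercRepro.MSTight

open Finset
open scoped FinsetFamily

variable {α : Type*} [DecidableEq α] [Fintype α]

section Bridge

variable {F : Finset (Finset α)} {u : Finset α} {r : α}

/-- **`F ∪ {ū}` is tight when every `r`-lifted face `t` has `t ∩ u₀ ∈ Y`** (`ū = univ ∖ u`,
`u₀ = u.erase r`, `r ∈ u`, `ū ∈ P`): every new difference is old. -/
theorem tight_insert_ubar_of_forall (hF : (F \\ F).card = F.card + 1) (hP : Tight (proj r F))
    (hr : ({r} : Finset α) ∈ F) (hsing : ∀ a, a ≠ r → ({a} : Finset α) ∈ proj r F)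
    (hru : r ∈ u) (hubar : univ \ u ∈ proj r F) (hnot : univ \ u ∉ F)
    (hall : ∀ t ∈ partr r F, t ∩ u.erase r ∈ diffsY r F) : Tight (insert (univ \ u) F) := by
  have hX : diffsX r F = proj r F := diffsX_eq_proj_of_singleton_mem hP hr
  have hface : ∀ e ∈ proj r F, e ∈ F \\ F := by
    intro e he
    rw [← hX, ← diffs_filter_notMem] at he
    exact (mem_filter.1 he).1
  have hrub : r ∉ univ \ u := fun h => (mem_sdiff.1 h).2 hru
  have hsub : insert (univ \ u) F \\ insert (univ \ u) F ⊆ F \\ F := by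
    intro E hE
    obtain ⟨A, hA, B, hB, rfl⟩ := Finset.mem_diffs.1 hE
    rcases mem_insert.1 hA with rfl | hA <;> rcases mem_insert.1 hB with rfl | hB
    · rw [Finset.sdiff_self]
      exact Finset.mem_diffs.2 ⟨{r}, hr, {r}, hr, Finset.sdiff_self _⟩
    · -- `(univ ∖ u) ∖ B ⊆ univ ∖ u`, a face
      exact hface _ (mem_proj_of_subset hP hr hsing hubar sdiff_subset)
    · by_cases hrA : r ∈ A
      · -- `A ∖ (univ ∖ u) = insert r (t ∩ u₀)` with `t = A.erase r ∈ F₁`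
        have ht : A.erase r ∈ partr r F :=
          mem_partr.2 ⟨notMem_erase r A, by rw [insert_erase hrA]; exact hA⟩
        have h1 : A \ (univ \ u) = insert r (A.erase r ∩ u.erase r) := by
          ext a
          simp only [mem_sdiff, mem_univ, true_and, not_not, mem_insert, mem_inter, mem_erase]
          constructor
          · rintro ⟨ha, hau⟩
            by_cases har : a = r
            · exact Or.inl har
            · exact Or.inr ⟨⟨har, ha⟩, har, hau⟩
          · rintro (rfl | ⟨⟨_, ha⟩, _, hau⟩)
            · exact ⟨hrA, hru⟩
            · exact ⟨ha, hau⟩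
        rw [h1]
        have h2 := hall _ ht
        have : insert r (A.erase r ∩ u.erase r) ∈ (F \\ F).filter (fun E => r ∈ E) := by
          rw [diffs_filter_mem]
          exact mem_image_of_mem _ h2
        exact (mem_filter.1 this).1
      · -- `A ∖ (univ ∖ u) = A ∩ u ⊆ A`, a face
        have h1 : A \ (univ \ u) ⊆ A := sdiff_subset
        have h2 : A ∈ proj r F := by
          rw [← erase_eq_of_notMem hrA]
          exact mem_proj.2 ⟨A, hA, rfl⟩
        exact hface _ (mem_proj_of_subset hP hr hsing h2 h1)
    · exact Finset.sdiff_mem_diffs hA hB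
  have hcard : (insert (univ \ u) F).card = F.card + 1 := card_insert_of_notMem hnot
  have h1 := card_le_card hsub
  have h2 := Finset.card_le_card_diffs (insert (univ \ u) F)
  unfold Tight
  omega

/-- **A residue instance in the mixed class.** With a tight trace at `r ∈ u`, `{r} ∈ F`,
`u ≠ univ` and `u.erase r ∉ F`, the residue data give `MixedII r F (u.erase r)`. -/
theorem MixedII.of_residue (h : Residue F u) (hP : Tight (proj r F)) (hr : ({r} : Finset α) ∈ F)
    (hru : r ∈ u) (huniv : u ≠ univ) (hI : u.erase r ∉ F) : MixedII r F (u.erase r) := by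
  have hsing : ∀ a, a ≠ r → ({a} : Finset α) ∈ proj r F := fun a ha =>
    singleton_mem_proj_of_twinFree h.hexc hP hr (fun a b hab => (h.htf a b hab).symm) h.hsupp ha
  have hII : univ \ u.erase r ∈ F :=
    (erase_mem_or_compl_erase_mem hP h.nonempty hru h.hu h.hu' h.hsig).resolve_left hI
  have hub1 : ubar r (u.erase r) ∈ partr r F := by
    rw [ubar_erase_eq hru]
    exact mem_partr.2 ⟨fun h' => (mem_sdiff.1 h').2 hru, by rw [insert_compl_eq hru]; exact hII⟩
  have hX : diffsX r F = proj r F := diffsX_eq_proj_of_singleton_mem hP hr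
  refine ⟨h.hexc, hP, hr, h.hempty, h.htf, h.hcore, hsing, notMem_erase r u, ?_, hub1, ?_, ?_,
    ?_, ?_, ?_⟩
  · -- `u₀` is not a face
    intro hmem
    rcases RMStar.part0_or_partr hmem with h0 | h1
    · exact hI (mem_part0.1 h0).1
    · have := (mem_partr.1 h1).2
      rw [insert_erase hru] at this
      exact h.hu this
  · -- `ū` is not a member
    rw [ubar_erase_eq hru]
    intro h0
    exact h.hu' (mem_part0.1 h0).1
  · -- `ū ≠ ∅`
    rw [ubar_erase_eq hru, nonempty_iff_ne_empty, Ne, sdiff_eq_empty_iff_subset]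
    intro hsub
    exact huniv (Subset.antisymm (subset_univ u) hsub)
  · -- the signs (†), read off the members `insert r t`
    intro t ht
    have hrt : r ∉ t := (mem_partr.1 ht).1
    have htF : insert r t ∈ F := (mem_partr.1 ht).2
    rcases h.hsig _ htF with ⟨hA, _⟩ | ⟨_, hC⟩
    · left
      have h1 : insert r t ∩ u = insert r (t ∩ u.erase r) := by
        ext a
        simp only [mem_inter, mem_insert, mem_erase]
        constructor
        · rintro ⟨(rfl | ha), hau⟩
          · exact Or.inl rfl
          · exact Or.inr ⟨ha, fun har => hrt (har ▸ ha), hau⟩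
        · rintro (rfl | ⟨ha, _, hau⟩)
          · exact ⟨Or.inl rfl, hru⟩
          · exact ⟨Or.inr ha, hau⟩
      rw [h1] at hA
      have h2 : insert r (t ∩ u.erase r) ∈ (F \\ F).filter (fun E => r ∈ E) :=
        mem_filter.2 ⟨hA, mem_insert_self r _⟩
      rw [diffs_filter_mem] at h2
      obtain ⟨y, hy, hy'⟩ := mem_image.1 h2
      have hry : r ∉ y := notMem_of_mem_diffsY hy
      have hry' : r ∉ t ∩ u.erase r := fun h' => hrt (mem_inter.1 h').1
      have : y = t ∩ u.erase r := by rw [← erase_insert hry, hy', erase_insert hry']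
      rw [← this]
      exact hy
    · right
      rw [Finset.sdiff_sdiff_eq_self (subset_univ u)] at hC
      have h1 : (univ \ insert r t) ∩ u = u.erase r \ t := by
        ext a
        simp only [mem_inter, mem_sdiff, mem_univ, true_and, mem_insert, not_or, mem_erase]
        tauto
      rw [h1] at hC
      have h2 : u.erase r \ t ∈ (F \\ F).filter (fun E => r ∉ E) :=
        mem_filter.2 ⟨hC, fun h' => (mem_erase.1 (mem_sdiff.1 h').1).1 rfl⟩
      rw [diffs_filter_notMem, hX] at h2
      exact h2
  · -- the C*-only member (‡), from `F ∪ {ū}` not tight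
    by_contra hcon
    apply h.hnt'
    refine tight_insert_ubar_of_forall h.hexc hP hr hsing hru ?_ h.hu' ?_
    · rw [← ubar_erase_eq hru]
      exact RMStar.mem_proj_of_mem_partr hub1
    · intro t ht
      by_contra hY
      exact hcon ⟨t, ht, hY⟩
  · -- validity
    intro t ht s hs hd hts
    have hrs : r ∉ s := (mem_part0.1 hs).2
    have heq : univ \ s = insert r t := by
      ext a
      by_cases har : a = r
      · subst har
        simp only [mem_sdiff, mem_univ, true_and, mem_insert, true_or, iff_true]
        exact hrs
      · have ha : a ∈ univ.erase r := mem_erase.2 ⟨har, mem_univ a⟩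
        rw [← hts, mem_union] at ha
        simp only [mem_sdiff, mem_univ, true_and, mem_insert, har, false_or]
        constructor
        · intro has
          exact ha.resolve_right has
        · intro hat has
          exact Finset.disjoint_left.1 hd hat has
    have := h.hvalid s (mem_part0.1 hs).1
    rw [heq] at this
    exact this (mem_partr.1 ht).2

/-- **`CaseIOfComplex` from the emptiness of the mixed class** (and «no residue near-member is
`univ`»). -/
theorem caseIOfComplex_of_not_mixed
    (hM : ∀ (F : Finset (Finset α)) (u₀ : Finset α) (r : α), MixedII r F u₀ → False)
    (hU : ∀ (F : Finset (Finset α)) (u : Finset α), Residue F u → u ≠ univ) : CaseIOfComplex α := by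
  intro F u r h hP hru hr
  by_contra hI
  exact hM F (u.erase r) r (MixedII.of_residue h hP hr hru (hU F u h) hI)

end Bridge

section Consequences

variable {r : α} {F : Finset (Finset α)} {u₀ : Finset α}

namespace MixedII

/-- No member avoiding `r` lies inside `ū`. -/
theorem notMem_part0_of_subset_ubar (h : MixedII r F u₀) {s : Finset α} (hs : s ⊆ ubar r u₀) :
    s ∉ part0 r F := by
  intro hs0
  have hup := h.monotone.2
  exact h.ubar_notMem_part0 (hup s hs0 _ h.ubar_mem_proj hs)

/-- A C*-only witness `w = t₁ ∩ u₀` is an `r`-lifted face. -/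
theorem witness_mem_partr (h : MixedII r F u₀) {t : Finset α} (ht : t ∈ partr r F) :
    t ∩ u₀ ∈ partr r F :=
  h.monotone.1 t ht _ (mem_proj_of_subset h.tightP h.singleton_mem h.sing
    (RMStar.mem_proj_of_mem_partr ht) inter_subset_left) inter_subset_left

/-- A C*-only witness meets every member avoiding `r`. -/
theorem witness_meets (h : MixedII r F u₀) {t : Finset α} (ht : t ∈ partr r F)
    (hY : t ∩ u₀ ∉ diffsY r F) {s : Finset α} (hs : s ∈ part0 r F) : ¬ Disjoint (t ∩ u₀) s :=
  fun hd => hY (mem_diffsY_of_disjoint (h.witness_mem_partr ht) hs hd)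

/-- `u₀ ∖ w` is a face for a C*-only witness `w = t₁ ∩ u₀`, by the sign at `t₁`. -/
theorem sdiff_witness_mem_proj (h : MixedII r F u₀) {t : Finset α} (ht : t ∈ partr r F)
    (hY : t ∩ u₀ ∉ diffsY r F) : u₀ \ (t ∩ u₀) ∈ proj r F := by
  have := (h.signs t ht).resolve_left hY
  have heq : u₀ \ (t ∩ u₀) = u₀ \ t := by
    ext a; simp only [mem_sdiff, mem_inter, not_and]; tauto
  rw [heq]
  exact this

/-- `u₀ ∖ w` is an `r`-lifted face: it avoids `w`, which every member avoiding `r` meets. -/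
theorem sdiff_witness_mem_partr (h : MixedII r F u₀) {t : Finset α} (ht : t ∈ partr r F)
    (hY : t ∩ u₀ ∉ diffsY r F) : u₀ \ (t ∩ u₀) ∈ partr r F := by
  have hP := h.sdiff_witness_mem_proj ht hY
  rcases RMStar.part0_or_partr hP with h0 | h1
  · exfalso
    exact h.witness_meets ht hY h0 (Finset.disjoint_sdiff)
  · exact h1

end MixedII

end Consequences

end PercRepro.MSTight
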